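import Literature.MathematicalPhysics.QuantumLattice.FinDimSpectrumSectorGibbsLimit
import HarnessLib

/-!
# The canonical (sector) partition function is at least the Boltzmann weight of the sector energy

Topic `Literature/MathematicalPhysics/QuantumLattice`, companion of `FinDimSpectrumSectorGibbsLimit`
(the `β → ∞` limit of the sector Gibbs state). For a Hermitian matrix `H`, an `H`-INVARIANT subspace
`K ≤ ℂⁿ` (a symmetry sector) with orthogonal projection `P_K` (`projMatrix`, transported to
`EuclideanSpace` as in `LTQOProofs`), sector energy `e₀ = H.minEnergyOn K` and sector ground
eigenspace `E₀ = K ⊓ ker (H - e₀) ≠ ⊥`, the canonical partition function `Z_K(β) = tr (P_K e^{-βH})`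
(`e^{-βH} = Matrix.gibbsWeight β H`) satisfies, for EVERY real `β`,

* `re_trace_proj_mul_conj_diagonal_eq` — `tr (P_K · U diag(v) U⋆) = Σᵢ vᵢ ‖P_K uᵢ‖²` for real
  weights `v` and any matrix `U` with columns `uᵢ` (so it is real and MONOTONE in `v`,
  `re_trace_proj_mul_conj_diagonal_mono`);
* **`finrank_mul_exp_le_re_trace_proj_gibbsWeight`** — `dim E₀ · e^{-βe₀} ≤ Z_K(β)`, hence
  **`exp_neg_mul_minEnergyOn_le_re_trace_proj_gibbsWeight`** — `e^{-βe₀} ≤ Z_K(β)` (one eigenvalue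
  bounds the trace from below: in the eigenbasis of `H`, `Z_K(β) = Σᵢ e^{-βλᵢ} ‖P_K uᵢ‖²`, the
  eigenvectors below `e₀` are killed by `P_K`, and `Σ_{λᵢ = e₀} ‖P_K uᵢ‖² = tr P_{E₀} = dim E₀ ≥ 1`);
* `re_trace_proj_gibbsWeight_pos` — `0 < Z_K(β)`;
* **`neg_log_re_trace_proj_gibbsWeight_div_le_minEnergyOn`** — the SECTOR FREE ENERGY IS AT MOST
  THE SECTOR ENERGY: `-β⁻¹ log Z_K(β) ≤ e₀` for `β > 0` (the trivial end of Peierls–Bogoliubov; the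
  "descent" from a twisted free energy to a twisted ground energy used by helicity-modulus arguments).

Folklore finite-dimensional statistical mechanics; no definition is introduced.
Sources: O. Bratteli, D. W. Robinson, *Operator Algebras and Quantum Statistical Mechanics II*,
§5.3.1 (Gibbs states, `F = -β⁻¹ log Z ≤ ⟨H⟩`); H. Tasaki, *Physics and Mathematics of Quantum
Many-Body Systems* (2020), App. A.2–A.4; B. Simon, *The Statistical Mechanics of Lattice Gases I*
(1993), §II.1 (`log tr e^{A}` and its elementary bounds).

## Mathlib / tree search
REUSED: `projMatrix` (+ `projMatrix_isHermitian`, `projMatrix_mul_self`), `Matrix.gibbsWeight`,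
`Matrix.minEnergyOn`, `trace_projMatrix_map_eq_finrank`, `projMatrix_map_mulVec_eigenvector_below_eq_zero`,
`projMatrix_map_mul_spectralIndicator_eq` (all `FinDimSpectrumSectorGibbsLimit`); Mathlib
`Matrix.IsHermitian.cfc_eq`, `eigenvectorUnitary`, `Matrix.trace_mul_cycle`. Searched `lean search`
for `sectorPartition|partitionFnOn|sectorFreeEnergy` (none) and `gibbsWeight.*proj` (only the limit
theorem above and `DuhamelEqualTimeBounds.trace_gibbsWeight_mul_proj_conjTranspose_mul`).
-/

noncomputable section

open scoped Matrix.Norms.L2Operator ComplexOrder MatrixOrder InnerProductSpace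

namespace Literature.MathematicalPhysics.QuantumLattice

open Matrix

section SectorPartitionFloor

variable {n : Type*} [Fintype n] [DecidableEq n]

/-- **`tr (P · U diag(v) U⋆) = Σᵢ vᵢ ‖P uᵢ‖²`** for a Hermitian idempotent `P`, any matrix `U` (columns
`uᵢ`) and real weights `v`: the real part of the trace is the weighted sum of the squared norms of the
projected columns, `‖P uᵢ‖² = Σ_k |(P U)_{k i}|²`. Tasaki (2020) App. A.2. [folklore] -/
theorem re_trace_proj_mul_conj_diagonal_eq {P : Matrix n n ℂ} (hP : P.IsHermitian) (hPP : P * P = P)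
    (U : Matrix n n ℂ) (v : n → ℝ) :
    ((P * (U * diagonal (fun i => (v i : ℂ)) * star U)).trace).re =
      ∑ i : n, v i * ∑ k : n, ‖(P * U) k i‖ ^ 2 := by
  -- cyclicity: `tr (P U D U⋆) = tr (U⋆ P U D) = Σᵢ (U⋆ P U)ᵢᵢ vᵢ`
  have hcyc : (P * (U * diagonal (fun i => (v i : ℂ)) * star U)).trace =
      ((star U * P * U) * diagonal (fun i => (v i : ℂ))).trace := by
    rw [show P * (U * diagonal (fun i => (v i : ℂ)) * star U) =
        (P * U * diagonal (fun i => (v i : ℂ))) * star U by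
          simp only [Matrix.mul_assoc],
      trace_mul_comm, ← Matrix.mul_assoc, ← Matrix.mul_assoc]
  -- the diagonal entries of `U⋆ P U` are the squared norms of the projected columns
  have hdiag : ∀ i : n, (star U * P * U) i i = ((∑ k : n, ‖(P * U) k i‖ ^ 2 : ℝ) : ℂ) := by
    intro i
    have h1 : star U * P * U = star (P * U) * (P * U) := by
      rw [star_mul, Matrix.star_eq_conjTranspose P, hP.eq, Matrix.mul_assoc (star U) P (P * U),
        ← Matrix.mul_assoc P P U, hPP, Matrix.mul_assoc]
    rw [h1, Matrix.mul_apply]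
    push_cast
    refine Finset.sum_congr rfl fun k _ => ?_
    rw [Matrix.star_apply, Complex.star_def, Complex.conj_mul']
  rw [hcyc, trace, Complex.re_sum]
  refine Finset.sum_congr rfl fun i _ => ?_
  rw [Matrix.diag_apply, mul_diagonal, hdiag i, ← Complex.ofReal_mul, Complex.ofReal_re, mul_comm]

/-- **Monotonicity of `v ↦ tr (P · U diag(v) U⋆)`** in the real weights (`P` a Hermitian idempotent):
termwise, `vᵢ ‖P uᵢ‖² ≤ wᵢ ‖P uᵢ‖²`. [folklore] -/
theorem re_trace_proj_mul_conj_diagonal_mono {P : Matrix n n ℂ} (hP : P.IsHermitian)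
    (hPP : P * P = P) (U : Matrix n n ℂ) {v w : n → ℝ} (hvw : ∀ i, v i ≤ w i) :
    ((P * (U * diagonal (fun i => (v i : ℂ)) * star U)).trace).re ≤
      ((P * (U * diagonal (fun i => (w i : ℂ)) * star U)).trace).re := by
  rw [re_trace_proj_mul_conj_diagonal_eq hP hPP, re_trace_proj_mul_conj_diagonal_eq hP hPP]
  exact Finset.sum_le_sum fun i _ =>
    mul_le_mul_of_nonneg_right (hvw i) (Finset.sum_nonneg fun k _ => by positivity)

/-- **`dim E₀ · e^{-βe₀} ≤ Z_K(β) = re tr (P_K e^{-βH})`** for a Hermitian `H`, an `H`-invariant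
subspace `K` with sector energy `e₀ = minEnergyOn H K` and sector ground eigenspace
`E₀ = K ⊓ ker (H - e₀)`, and every real `β`: in the eigenbasis `e^{-βH} = U diag(e^{-βλᵢ}) U⋆` the
columns with `λᵢ < e₀` are killed by `P_K`, so `Z_K(β) = e^{-βe₀} Σ_{λᵢ ≥ e₀} e^{-β(λᵢ-e₀)} ‖P_K uᵢ‖²
≥ e^{-βe₀} Σ_{λᵢ = e₀} ‖P_K uᵢ‖² = e^{-βe₀} tr P_{E₀} = e^{-βe₀} dim E₀`. Bratteli–Robinson II §5.3.1;
Tasaki (2020) App. A.4. [folklore] -/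
theorem finrank_mul_exp_le_re_trace_proj_gibbsWeight {H : Matrix n n ℂ} (hH : H.IsHermitian)
    (K : Submodule ℂ (n → ℂ)) (hinv : ∀ v ∈ K, H *ᵥ v ∈ K) (β : ℝ) :
    (Module.finrank ℂ ↥(K ⊓ Module.End.eigenspace (Matrix.toLin' H) ((H.minEnergyOn K : ℝ) : ℂ)) : ℝ) *
        Real.exp (-(β * H.minEnergyOn K)) ≤
      ((projMatrix (K.map ((WithLp.linearEquiv 2 ℂ (n → ℂ)).symm :
          (n → ℂ) →ₗ[ℂ] EuclideanSpace ℂ n)) * gibbsWeight β H).trace).re := by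
  set e₀ : ℝ := H.minEnergyOn K with he₀
  set E₀ : Submodule ℂ (n → ℂ) := K ⊓ Module.End.eigenspace (Matrix.toLin' H) ((e₀ : ℝ) : ℂ)
    with hE₀def
  set P := projMatrix (K.map ((WithLp.linearEquiv 2 ℂ (n → ℂ)).symm :
    (n → ℂ) →ₗ[ℂ] EuclideanSpace ℂ n)) with hP
  set P₀ := projMatrix (E₀.map ((WithLp.linearEquiv 2 ℂ (n → ℂ)).symm :
    (n → ℂ) →ₗ[ℂ] EuclideanSpace ℂ n)) with hP₀
  set U : Matrix n n ℂ := (hH.eigenvectorUnitary : Matrix n n ℂ) with hU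
  have hPherm : P.IsHermitian := projMatrix_isHermitian _
  have hPP : P * P = P := projMatrix_mul_self _
  -- the real weights: truncated, rescaled Boltzmann factors and the indicator of `{λᵢ = e₀}`
  let dR : n → ℝ := fun i => if hH.eigenvalues i < e₀ then 0 else Real.exp (-(β * (hH.eigenvalues i - e₀)))
  let vR : n → ℝ := fun i => if hH.eigenvalues i = e₀ then 1 else 0
  -- the columns of `U` are eigenvectors; those below `e₀` are killed by `P`
  have hcol : ∀ j, H *ᵥ (fun i => U i j) = ((hH.eigenvalues j : ℝ) : ℂ) • (fun i => U i j) := by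
    intro j
    have h : (fun i => U i j) = ⇑(hH.eigenvectorBasis j) :=
      funext fun i => IsHermitian.eigenvectorUnitary_apply hH i j
    rw [h, hH.mulVec_eigenvectorBasis j, RCLike.real_smul_eq_coe_smul (K := ℂ)]
    rfl
  have hPU0 : ∀ i j, hH.eigenvalues j < e₀ → (P * U) i j = 0 := by
    intro i j hj
    have h := projMatrix_map_mulVec_eigenvector_below_eq_zero hH K hinv (hcol j) hj
    have h2 : (P * U) i j = (P *ᵥ fun k => U k j) i := by
      simp only [mul_apply, mulVec, dotProduct]
    rw [h2, hP, h, Pi.zero_apply]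
  -- (1) `P e^{-βH} = e^{-βe₀} • P (U diag(dR) U⋆)`
  have hG : P * gibbsWeight β H =
      (Real.exp (-(β * e₀)) : ℂ) • (P * (U * diagonal (fun i => (dR i : ℂ)) * star U)) := by
    have hsmul : (-(β : ℂ) • H : Matrix n n ℂ) = (-β : ℝ) • H := by
      ext i j
      simp [Matrix.smul_apply, Complex.real_smul]
    have h1 : gibbsWeight β H = cfc (fun x : ℝ => Real.exp ((-β) • x)) H := by
      rw [gibbsWeight, hsmul, cfc_comp_smul (-β) Real.exp H, CFC.real_exp_eq_normedSpace_exp]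
    have h2 : gibbsWeight β H =
        U * diagonal (fun i => (Real.exp (-(β * hH.eigenvalues i)) : ℂ)) * star U := by
      rw [h1, hH.cfc_eq, IsHermitian.cfc, Unitary.conjStarAlgAut_apply]
      simp only [smul_eq_mul, neg_mul]
      rfl
    have h3 : P * U * diagonal (fun i => (Real.exp (-(β * hH.eigenvalues i)) : ℂ)) =
        (Real.exp (-(β * e₀)) : ℂ) • (P * U * diagonal (fun i => (dR i : ℂ))) := by
      ext i j
      rw [Matrix.smul_apply, mul_diagonal, mul_diagonal, smul_eq_mul]
      by_cases hj : hH.eigenvalues j < e₀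
      · rw [hPU0 i j hj, zero_mul, zero_mul, mul_zero]
      · simp only [dR, if_neg hj]
        rw [mul_left_comm, ← Complex.ofReal_mul, ← Real.exp_add]
        have : -(β * e₀) + -(β * (hH.eigenvalues j - e₀)) = -(β * hH.eigenvalues j) := by ring
        rw [this]
    calc P * gibbsWeight β H
          = P * U * diagonal (fun i => (Real.exp (-(β * hH.eigenvalues i)) : ℂ)) * star U := by
            rw [h2, ← Matrix.mul_assoc, ← Matrix.mul_assoc]
      _ = (Real.exp (-(β * e₀)) : ℂ) • (P * (U * diagonal (fun i => (dR i : ℂ)) * star U)) := by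
            rw [h3, Matrix.smul_mul]
            congr 1
            simp only [Matrix.mul_assoc]
  -- (2) the indicator weights give `tr P₀ = dim E₀`
  have hind : ((P * (U * diagonal (fun i => (vR i : ℂ)) * star U)).trace).re =
      (Module.finrank ℂ E₀ : ℝ) := by
    have hv : (fun i => (vR i : ℂ)) = fun i => if hH.eigenvalues i = e₀ then (1 : ℂ) else 0 := by
      funext i
      simp only [vR]
      split_ifs <;> simp
    have hlim : P * (U * diagonal (fun i => if hH.eigenvalues i = e₀ then (1 : ℂ) else 0) * star U) = P₀ :=
      projMatrix_map_mul_spectralIndicator_eq hH K hinv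
    rw [hv, hlim, hP₀, trace_projMatrix_map_eq_finrank, Complex.natCast_re]
  -- (3) `vR ≤ dR` termwise, so `dim E₀ ≤ tr (P U diag(dR) U⋆)`
  have hle : ∀ i, vR i ≤ dR i := by
    intro i
    by_cases hlt : hH.eigenvalues i < e₀
    · simp only [vR, dR, if_neg hlt.ne, if_pos hlt]
      exact le_refl _
    · by_cases heq : hH.eigenvalues i = e₀
      · simp only [vR, dR, if_pos heq, if_neg hlt, heq, sub_self, mul_zero, neg_zero, Real.exp_zero]
        exact le_refl _
      · simp only [vR, dR, if_neg heq, if_neg hlt]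
        exact (Real.exp_pos _).le
  have hmono := re_trace_proj_mul_conj_diagonal_mono hPherm hPP U hle
  rw [hind] at hmono
  -- (4) assemble
  rw [hG, trace_smul, smul_eq_mul, Complex.re_ofReal_mul, mul_comm]
  exact mul_le_mul_of_nonneg_left hmono (Real.exp_pos _).le

/-- **`e^{-βe₀} ≤ Z_K(β) = re tr (P_K e^{-βH})`**: the canonical partition function of an invariant
sector with non-trivial ground eigenspace is at least the Boltzmann weight of the sector energy
(`dim E₀ ≥ 1` in `finrank_mul_exp_le_re_trace_proj_gibbsWeight`). Bratteli–Robinson II §5.3.1.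
[folklore] -/
theorem exp_neg_mul_minEnergyOn_le_re_trace_proj_gibbsWeight {H : Matrix n n ℂ} (hH : H.IsHermitian)
    (K : Submodule ℂ (n → ℂ)) (hinv : ∀ v ∈ K, H *ᵥ v ∈ K)
    (hE₀ : K ⊓ Module.End.eigenspace (Matrix.toLin' H) ((H.minEnergyOn K : ℝ) : ℂ) ≠ ⊥) (β : ℝ) :
    Real.exp (-(β * H.minEnergyOn K)) ≤
      ((projMatrix (K.map ((WithLp.linearEquiv 2 ℂ (n → ℂ)).symm :
          (n → ℂ) →ₗ[ℂ] EuclideanSpace ℂ n)) * gibbsWeight β H).trace).re := by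
  have h := finrank_mul_exp_le_re_trace_proj_gibbsWeight hH K hinv β
  have h1 : (1 : ℝ) ≤ (Module.finrank ℂ
      ↥(K ⊓ Module.End.eigenspace (Matrix.toLin' H) ((H.minEnergyOn K : ℝ) : ℂ)) : ℝ) := by
    exact_mod_cast Submodule.one_le_finrank_iff.mpr hE₀
  nlinarith [Real.exp_pos (-(β * H.minEnergyOn K))]

/-- **`0 < Z_K(β)`** under the same hypotheses. [folklore] -/
theorem re_trace_proj_gibbsWeight_pos {H : Matrix n n ℂ} (hH : H.IsHermitian)
    (K : Submodule ℂ (n → ℂ)) (hinv : ∀ v ∈ K, H *ᵥ v ∈ K)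
    (hE₀ : K ⊓ Module.End.eigenspace (Matrix.toLin' H) ((H.minEnergyOn K : ℝ) : ℂ) ≠ ⊥) (β : ℝ) :
    0 < ((projMatrix (K.map ((WithLp.linearEquiv 2 ℂ (n → ℂ)).symm :
          (n → ℂ) →ₗ[ℂ] EuclideanSpace ℂ n)) * gibbsWeight β H).trace).re :=
  lt_of_lt_of_le (Real.exp_pos _) (exp_neg_mul_minEnergyOn_le_re_trace_proj_gibbsWeight hH K hinv hE₀ β)

/-- **The sector free energy is at most the sector energy**: `-β⁻¹ log Z_K(β) ≤ e₀ = minEnergyOn H K`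
for `β > 0` (take logarithms in `e^{-βe₀} ≤ Z_K(β)`): the elementary "descent" from a canonical free
energy to the canonical ground energy, the trivial end of the Peierls–Bogoliubov inequality.
Bratteli–Robinson II §5.3.1; Simon (1993) §II.1. [folklore] -/
theorem neg_log_re_trace_proj_gibbsWeight_div_le_minEnergyOn {H : Matrix n n ℂ} (hH : H.IsHermitian)
    (K : Submodule ℂ (n → ℂ)) (hinv : ∀ v ∈ K, H *ᵥ v ∈ K)
    (hE₀ : K ⊓ Module.End.eigenspace (Matrix.toLin' H) ((H.minEnergyOn K : ℝ) : ℂ) ≠ ⊥)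
    {β : ℝ} (hβ : 0 < β) :
    -Real.log ((projMatrix (K.map ((WithLp.linearEquiv 2 ℂ (n → ℂ)).symm :
          (n → ℂ) →ₗ[ℂ] EuclideanSpace ℂ n)) * gibbsWeight β H).trace).re / β ≤ H.minEnergyOn K := by
  have h := exp_neg_mul_minEnergyOn_le_re_trace_proj_gibbsWeight hH K hinv hE₀ β
  have hlog := Real.log_le_log (Real.exp_pos _) h
  rw [Real.log_exp] at hlog
  rw [div_le_iff₀ hβ]
  linarith

end SectorPartitionFloor

end Literature.MathematicalPhysics.QuantumLattice

end
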